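import Summits.AnomalousDissipation.AnomalousDissipation.Theorems.QuasiStaticSolenoidalCellTensorQ.Negative.WindowFloor
import Summits.AnomalousDissipation.AnomalousDissipation.Theorems.QuasiStaticSolenoidalCellTensorQ.Negative.Frozen
import Summits.AnomalousDissipation.AnomalousDissipation.Theorems.QuasiStaticSolenoidalCellTensorQ.Negative.PeriodIntegral
import Summits.AnomalousDissipation.AnomalousDissipation.Theorems.SolenoidalFractalHomogenisationRealisedQuasiStaticCellLawSectorExpDecay
import HarnessLib

/-!
# Negative side of K2Q `QuasiStaticSolenoidalCellTensorQ` (stmt-AnomalousDissipation-19072): the window step of the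
# general-word energy floor (helper, `--supports stmt-AnomalousDissipation-19072`)

Summits-side helper file (everything proved; no definitions, no named facts).  `window_step` runs the abstract window floor
lemma `window_floor` on the Galerkin truncation of the passive solenoidal vector around the cells of an ARBITRARY lattice word,
on a window of `q` whole periods `[pP, (p+q)P] ⊆ [0, T]`: with `x` the principal pair energy, `R` the rest energy,
`v₀ = α_N(pP)(ℓ)`, the frozen per-slot drain constants
`Γ_j = ½(1/n)²(2πΣᵢê_j,ᵢℓᵢ)²(‖a_j‖²+‖a'_j‖²)·Σ_∓ ((1+ε)‖Π_{ℓ∓K_j}v₀‖² + (1+1/ε)δ²)/(κ4π²|ℓ∓K_j|²)`,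
`δ = e^{κ4π²|ℓ|²qP}·c_F·√(x(pP)+R(pP))·qP`, one gets for every `t` in the window
`x(pP) − R(pP) − 2κ4π²|ℓ|²(x(pP)+R(pP))·qP − 4q(1−4ρ/3)Σ_jτ_jΓ_j ≤ x(t)` and
`R((p+q)P) ≤ R(pP)e^{−κ4π²(n/2)²qP} + 4(Σ_jΓ_j)/(2κ4π²(n/2)²)`.
No long-slot hypothesis; no smallness hypothesis (those enter only when the windows are chained).
This is NOT a proof of anomalous dissipation, and by itself not of `¬ K2Q`.
-/

set_option linter.dupNamespace false

noncomputable section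

namespace Summit.AnomalousDissipation.AnomalousDissipation.Theorems.QuasiStaticSolenoidalCellTensorQ.Negative

open Set MeasureTheory Filter Topology Function intervalIntegral
open scoped InnerProductSpace ComplexConjugate BigOperators
open Literature.Analysis Literature.Analysis.FunctionSpaces Literature.Analysis.FunctionSpaces.Torus
open Literature.Analysis.FluidPDE Literature.Analysis.FluidPDE.LatticeShear
open Summit.AnomalousDissipation.AnomalousDissipation.Theorems.SolenoidalFractalHomogenisation.PermissibleCarrier
open Summit.AnomalousDissipation.AnomalousDissipation.Theorems.SolenoidalFractalHomogenisation.RealisedQuasiStaticCellLaw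

variable {k₀ : ℕ}

set_option maxHeartbeats 1600000 in
/-- **The window step.** See the module docstring. -/
theorem window_step (W : LatticeWord k₀) {n : ℕ} (hn : 0 < n) {κ : ℝ} (hκ : 0 < κ)
    (ℓ : Fin 3 → ℤ) (hℓ : ℓ ≠ 0) (hℓn : 2 * ‖latticeVec ℓ‖ < n) {w₀ : UnitAddTorus (Fin 3) → EuclideanSpace ℝ (Fin 3)}
    (hw₀ : FunctionSpaces.Torus.MemSobolev 1 (FunctionSpaces.EuclideanSpace.complexify ∘ w₀))
    (hdiv : FunctionSpaces.Torus.IsWeaklyDivFree w₀) (hmean : FunctionSpaces.Torus.HasZeroMean w₀)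
    (hsupp : ∀ k : Fin 3 → ℤ, ¬ ((∃ z : Fin 3 → ℤ, k = ℓ + (n:ℤ) • z) ∨ (∃ z : Fin 3 → ℤ, k = -ℓ + (n:ℤ) • z)) →
      UnitAddTorus.mFourierCoeff (FunctionSpaces.EuclideanSpace.complexify ∘ w₀) k = 0)
    {N : ℕ} (hBN : (Finset.univ.biUnion fun j : Fin k₀ =>
        ({(fun i => (W.phase j).m i * n), -(fun i => (W.phase j).m i * n)} : Finset (Fin 3 → ℤ))) ⊆ freqBall N)
    (hℓN : ℓ ∈ freqBall N)
    (hball : ∀ j : Fin k₀, ∀ k ∈ ({ℓ, -ℓ} : Finset (Fin 3 → ℤ)),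
      k - (fun i => (W.phase j).m i * (n : ℤ)) ∈ freqBall N ∧ k + (fun i => (W.phase j).m i * (n : ℤ)) ∈ freqBall N)
    {T : ℝ} (p q : ℕ) (hT : ((p : ℝ) + q) * W.period ≤ T) {ε : ℝ} (hε : 0 < ε) :
    let α := fun t k => (pvSetup_cell W hn hκ.le ℓ hw₀ hdiv hmean hsupp).galerkinCoeffAt N t k
    let x := fun t => ‖α t ℓ‖ ^ 2 + ‖α t (-ℓ)‖ ^ 2
    let R := fun t => ∑ k ∈ freqBall N \ {ℓ, -ℓ}, ‖α t k‖ ^ 2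
    let t₀ := (p : ℝ) * W.period
    let t₁ := ((p : ℝ) + q) * W.period
    let δ := Real.exp (κ * (4 * Real.pi ^ 2 * freqNormSq ℓ) * (t₁ - t₀)) *
      ((∑ j : Fin k₀, (1 / (n : ℝ)) * (2 * Real.pi * |∑ i, (W.phase j).e i * (ℓ i : ℝ)|) *
          (‖Complex.exp ((W.phase j).φ * Complex.I) *
              (1 / (2 * ((2 * Real.pi * ‖latticeVec (W.phase j).m‖ : ℝ) : ℂ) * Complex.I))‖ +
            ‖starRingEnd ℂ (Complex.exp ((W.phase j).φ * Complex.I)) *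
              (-(1 / (2 * ((2 * Real.pi * ‖latticeVec (W.phase j).m‖ : ℝ) : ℂ) * Complex.I)))‖)) *
        Real.sqrt (x t₀ + R t₀)) * (t₁ - t₀)
    let Γ := fun j : Fin k₀ => (1 / 2 : ℝ) * ((1 / (n : ℝ)) ^ 2 * (2 * Real.pi * ∑ i, (W.phase j).e i * (ℓ i : ℝ)) ^ 2) *
      (‖Complex.exp ((W.phase j).φ * Complex.I) *
          (1 / (2 * ((2 * Real.pi * ‖latticeVec (W.phase j).m‖ : ℝ) : ℂ) * Complex.I))‖ ^ 2 +
        ‖starRingEnd ℂ (Complex.exp ((W.phase j).φ * Complex.I)) *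
          (-(1 / (2 * ((2 * Real.pi * ‖latticeVec (W.phase j).m‖ : ℝ) : ℂ) * Complex.I)))‖ ^ 2) *
      (((1 + ε) * ‖Torus.leraySym (ℓ - (fun i => (W.phase j).m i * n)) (α t₀ ℓ)‖ ^ 2 + (1 + 1 / ε) * δ ^ 2) /
          (κ * (4 * Real.pi ^ 2 * freqNormSq (ℓ - (fun i => (W.phase j).m i * n)))) +
        ((1 + ε) * ‖Torus.leraySym (ℓ + (fun i => (W.phase j).m i * n)) (α t₀ ℓ)‖ ^ 2 + (1 + 1 / ε) * δ ^ 2) /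
          (κ * (4 * Real.pi ^ 2 * freqNormSq (ℓ + (fun i => (W.phase j).m i * n)))))
    (∀ t ∈ Icc t₀ t₁, x t₀ - R t₀ - 2 * (κ * (4 * Real.pi ^ 2 * freqNormSq ℓ)) * (x t₀ + R t₀) * (t - t₀) -
        4 * ((q : ℝ) * (1 - 4 * W.ramp / 3) * ∑ j, (W.phase j).τ * Γ j) ≤ x t) ∧
    (R t₁ ≤ R t₀ * Real.exp (-(2 * (κ * (4 * Real.pi ^ 2 * ((n : ℝ) / 2) ^ 2)) / 2) * (t₁ - t₀)) +
      4 * (∑ j, Γ j) / (2 * (κ * (4 * Real.pi ^ 2 * ((n : ℝ) / 2) ^ 2)))) := by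
  intro α x R t₀ t₁ δ Γ
  classical
  set hPV := pvSetup_cell W hn hκ.le ℓ hw₀ hdiv hmean hsupp with hPVdef
  have hP := period_pos W
  have ht₀0 : 0 ≤ t₀ := by show 0 ≤ (p : ℝ) * W.period; positivity
  have ht₀₁ : t₀ ≤ t₁ := by show (p : ℝ) * W.period ≤ ((p : ℝ) + q) * W.period; nlinarith
  have ht₁T : t₁ ≤ T := hT
  have hsub : Icc t₀ t₁ ⊆ Icc 0 T := fun t ht => ⟨ht₀0.trans ht.1, ht.2.trans ht₁T⟩
  have hℓℓ : ℓ ≠ -ℓ := by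
    intro h; apply hℓ; funext i; have hi := congrFun h i; simp only [Pi.neg_apply] at hi
    have : ℓ i = 0 := by omega
    simpa using this
  have hpair : ({ℓ, -ℓ} : Finset (Fin 3 → ℤ)) ⊆ freqBall N := by
    intro k hk; simp only [Finset.mem_insert, Finset.mem_singleton] at hk
    rcases hk with rfl | rfl
    · exact hℓN
    · exact neg_mem_freqBall_of_mem _ hℓN
  -- abbreviations of the slot data
  set A : Fin k₀ → ℂ := fun j => Complex.exp ((W.phase j).φ * Complex.I) *
      (1 / (2 * ((2 * Real.pi * ‖latticeVec (W.phase j).m‖ : ℝ) : ℂ) * Complex.I)) with hA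
  set A' : Fin k₀ → ℂ := fun j => starRingEnd ℂ (Complex.exp ((W.phase j).φ * Complex.I)) *
      (-(1 / (2 * ((2 * Real.pi * ‖latticeVec (W.phase j).m‖ : ℝ) : ℂ) * Complex.I))) with hA'
  set K : Fin k₀ → (Fin 3 → ℤ) := fun j => fun i => (W.phase j).m i * (n : ℤ) with hK
  set S : Fin k₀ → ℝ := fun j => ∑ i, (W.phase j).e i * (ℓ i : ℝ) with hS
  set trap : Fin k₀ → ℝ → ℝ := fun j t => LatticeWord.trapezoid (W.start j) (W.phase j).τ W.ramp
      (Int.fract (t / W.period) * W.period) with htrap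
  set C : Fin k₀ → ℝ → (Fin 3 → ℤ) → ℂ := fun j t k => ((((1 / (n : ℝ)) * trap j t : ℝ) : ℂ) *
      (2 * Real.pi * Complex.I * ∑ i, (EuclideanSpace.complexify (W.phase j).e) i * (k i : ℂ))) with hC
  -- the functions of the window floor lemma
  set lam : ℝ := 2 * (κ * (4 * Real.pi ^ 2 * freqNormSq ℓ)) with hlam
  set Λ : ℝ := 2 * (κ * (4 * Real.pi ^ 2 * ((n : ℝ) / 2) ^ 2)) with hΛ
  set D : ℝ → ℝ := fun t => 2 * (κ * (4 * Real.pi ^ 2 * ∑ k ∈ freqBall N \ {ℓ, -ℓ}, freqNormSq k * ‖α t k‖ ^ 2)) with hD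
  set τ : ℝ → ℝ := fun t => -(∑ k ∈ ({ℓ, -ℓ} : Finset (Fin 3 → ℤ)), 2 * (inner ℂ (α t k)
      (∑ j : Fin k₀, C j t k • Torus.leraySym k (A j • α t (k - K j) + A' j • α t (k + K j)))).re) with hτ
  set ψ : ℝ → ℝ := fun t => ∑ j, trap j t ^ 2 * Γ j with hψ
  set Φ : ℝ → ℝ := fun t => ∑ j, Γ j * ∫ s in t₀..t, trap j s ^ 2 with hΦ
  set Ψ : ℝ := ∑ j, Γ j with hΨ
  -- positivity facts
  have hw : ∀ m : Fin 3 → ℤ, 0 ≤ κ * (4 * Real.pi ^ 2 * freqNormSq m) := fun m =>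
    mul_nonneg hκ.le (mul_nonneg (by positivity) (freqNormSq_nonneg _))
  have hΓ0 : ∀ j, 0 ≤ Γ j := by
    intro j
    refine mul_nonneg (mul_nonneg (mul_nonneg (by norm_num) (by positivity)) (by positivity)) (add_nonneg ?_ ?_)
    · exact div_nonneg (by positivity) (hw _)
    · exact div_nonneg (by positivity) (hw _)
  have htrap01 : ∀ j t, 0 ≤ trap j t ∧ trap j t ≤ 1 := fun j t =>
    ⟨trapezoid_nonneg _ _ _ _, trapezoid_le_one _ _ _ _⟩
  -- (hx) the principal pair
  have hx : ∀ t ∈ Icc t₀ t₁, HasDerivWithinAt x (-(lam * x t) + τ t) (Icc t₀ t₁) t := by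
    intro t ht
    have h := (principalEnergy_hasDerivWithinAt W hn hκ.le ℓ hw₀ hdiv hmean hsupp hBN hℓ hℓN (hsub ht)).mono hsub
    refine h.congr_deriv ?_
    rw [hlam, hτ]
    ring
  -- (hE) the total energy and (hR) the rest
  have hxR : ∀ t, ∑ k ∈ freqBall N, ‖α t k‖ ^ 2 = x t + R t := by
    intro t
    rw [← Finset.sum_sdiff hpair, Finset.sum_pair hℓℓ]
    ring
  have hDsplit : ∀ t, 2 * (κ * (4 * Real.pi ^ 2 * ∑ k ∈ freqBall N, freqNormSq k * ‖α t k‖ ^ 2)) = lam * x t + D t := by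
    intro t
    rw [← Finset.sum_sdiff hpair, Finset.sum_pair hℓℓ, freqNormSq_neg, hlam, hD]
    ring
  have hR : ∀ t ∈ Icc t₀ t₁, HasDerivWithinAt R (-(D t) - τ t) (Icc t₀ t₁) t := by
    intro t ht
    have hE := (totalEnergy_hasDerivWithinAt W hn hκ.le ℓ hw₀ hdiv hmean hsupp N (hsub ht)).mono hsub
    have h := hE.sub (hx t ht)
    have e1 : R = fun s => (∑ k ∈ freqBall N, ‖hPV.galerkinCoeffAt N s k‖ ^ 2) - x s := by
      funext s; rw [hxR s]; ring
    rw [e1]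
    refine h.congr_deriv ?_
    rw [hDsplit t]
    ring
  -- (hΦ) the drain primitive
  have hΦd : ∀ t ∈ Icc t₀ t₁, HasDerivWithinAt Φ (ψ t) (Icc t₀ t₁) t := by
    intro t _
    have h := HasDerivWithinAt.fun_sum (u := (Finset.univ : Finset (Fin k₀))) fun j _ =>
      (hasDerivWithinAt_integral_trapSq W j t₀ (Icc t₀ t₁) t).const_mul (Γ j)
    refine h.congr_deriv (Finset.sum_congr rfl fun j _ => ?_)
    simp only [htrap]; ring
  have hΦ0 : Φ t₀ = 0 := by simp [hΦ]
  -- nonnegativity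
  have hx0 : ∀ t ∈ Icc t₀ t₁, 0 ≤ x t := fun t _ => by positivity
  have hR0 : ∀ t ∈ Icc t₀ t₁, 0 ≤ R t := fun t _ => Finset.sum_nonneg fun k _ => sq_nonneg _
  have hlam0 : 0 ≤ lam := by rw [hlam]; exact mul_nonneg (by norm_num) (hw ℓ)
  have hn' : (0:ℝ) < n := by exact_mod_cast hn
  have hΛ0 : 0 < Λ := by rw [hΛ]; positivity
  have hΨ0 : 0 ≤ Ψ := Finset.sum_nonneg fun j _ => hΓ0 j
  have hψΨ : ∀ t ∈ Icc t₀ t₁, ψ t ≤ Ψ := by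
    intro t _
    refine Finset.sum_le_sum fun j _ => ?_
    have h1 : trap j t ^ 2 ≤ 1 := by
      have := htrap01 j t; nlinarith
    nlinarith [hΓ0 j]
  -- (hD) the rest gap
  have hDR : ∀ t ∈ Icc t₀ t₁, Λ * R t ≤ D t := fun t _ => restGap_le W hn hκ.le ℓ hℓn.le hw₀ hdiv hmean hsupp N t
  -- (hτ) the exchange bound: `|τ| ≤ 2ψ_exact + D/2` and `ψ_exact ≤ ψ`
  have hrest : ∀ t ∈ Icc t₀ t₁, R t ≤ x t₀ + R t₀ := by
    intro t ht
    have h := totalEnergy_antitone W hn hκ.le ℓ hw₀ hdiv hmean hsupp N ht₀0 ht.1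
    rw [hxR, hxR] at h
    linarith [hx0 t ht]
  have hτb : ∀ t ∈ Icc t₀ t₁, |τ t| ≤ 2 * ψ t + D t / 2 := by
    intro t ht
    have hex := exchange_le_cell W hn hκ ℓ hℓ hℓn hw₀ hdiv hmean hsupp hball t
    -- the exact density is at most the frozen one
    have hψle : (1 / 2 : ℝ) * ∑ j : Fin k₀, ∑ k ∈ ({ℓ, -ℓ} : Finset (Fin 3 → ℤ)), ‖C j t k‖ ^ 2 *
        (‖A j‖ ^ 2 * ‖Torus.leraySym (k - K j) (α t k)‖ ^ 2 / (κ * (4 * Real.pi ^ 2 * freqNormSq (k - K j))) +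
          ‖A' j‖ ^ 2 * ‖Torus.leraySym (k + K j) (α t k)‖ ^ 2 / (κ * (4 * Real.pi ^ 2 * freqNormSq (k + K j)))) ≤ ψ t := by
      rw [hψ, Finset.mul_sum]
      refine Finset.sum_le_sum fun j _ => ?_
      have hpair_eq := drainDensity_pair_eq (hPV.isConjSymm_galerkinCoeffAt N t) hℓℓ (K j) ((1 / (n : ℝ)) * trap j t)
        (W.phase j).e (A j) (A' j) κ
      rw [hpair_eq, norm_sq_slotCoeff]
      -- frozen polarisation for the two fed frequencies
      have hf1 := polarisation_frozen W hn hκ ℓ hℓ hℓn hw₀ hdiv hmean hsupp hBN hℓN hball ht₀0 ht₀₁ ht₁T hrest (ℓ - K j) hε t ht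
      have hf2 := polarisation_frozen W hn hκ ℓ hℓ hℓn hw₀ hdiv hmean hsupp hBN hℓN hball ht₀0 ht₀₁ ht₁T hrest (ℓ + K j) hε t ht
      have hw1 := hw (ℓ - K j)
      have hw2 := hw (ℓ + K j)
      have hq1 : ‖Torus.leraySym (ℓ - K j) (α t ℓ)‖ ^ 2 / (κ * (4 * Real.pi ^ 2 * freqNormSq (ℓ - K j))) ≤
          ((1 + ε) * ‖Torus.leraySym (ℓ - K j) (α t₀ ℓ)‖ ^ 2 + (1 + 1 / ε) * δ ^ 2) /
            (κ * (4 * Real.pi ^ 2 * freqNormSq (ℓ - K j))) := div_le_div_of_nonneg_right hf1 hw1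
      have hq2 : ‖Torus.leraySym (ℓ + K j) (α t ℓ)‖ ^ 2 / (κ * (4 * Real.pi ^ 2 * freqNormSq (ℓ + K j))) ≤
          ((1 + ε) * ‖Torus.leraySym (ℓ + K j) (α t₀ ℓ)‖ ^ 2 + (1 + 1 / ε) * δ ^ 2) /
            (κ * (4 * Real.pi ^ 2 * freqNormSq (ℓ + K j))) := div_le_div_of_nonneg_right hf2 hw2
      have hc0 : 0 ≤ ((1 / (n : ℝ)) * trap j t) ^ 2 * (2 * Real.pi * ∑ i, (W.phase j).e i * (ℓ i : ℝ)) ^ 2 *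
          (‖A j‖ ^ 2 + ‖A' j‖ ^ 2) := by positivity
      have := mul_le_mul_of_nonneg_left (add_le_add hq1 hq2) hc0
      have e : (1 / 2 : ℝ) * (((1 / (n : ℝ)) * trap j t) ^ 2 * (2 * Real.pi * ∑ i, (W.phase j).e i * (ℓ i : ℝ)) ^ 2 *
          (‖A j‖ ^ 2 + ‖A' j‖ ^ 2) *
          (((1 + ε) * ‖Torus.leraySym (ℓ - K j) (α t₀ ℓ)‖ ^ 2 + (1 + 1 / ε) * δ ^ 2) /
              (κ * (4 * Real.pi ^ 2 * freqNormSq (ℓ - K j))) +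
            ((1 + ε) * ‖Torus.leraySym (ℓ + K j) (α t₀ ℓ)‖ ^ 2 + (1 + 1 / ε) * δ ^ 2) /
              (κ * (4 * Real.pi ^ 2 * freqNormSq (ℓ + K j))))) = trap j t ^ 2 * Γ j := by
        show _ = trap j t ^ 2 * ((1 / 2 : ℝ) * ((1 / (n : ℝ)) ^ 2 * (2 * Real.pi * S j) ^ 2) *
          (‖A j‖ ^ 2 + ‖A' j‖ ^ 2) * _)
        rw [hS]; ring
      rw [← e]
      linarith
    have e2 : (2 * (κ * (4 * Real.pi ^ 2 * ∑ k ∈ freqBall N \ {ℓ, -ℓ}, freqNormSq k * ‖α t k‖ ^ 2))) / 2 = D t / 2 := by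
      rw [hD]
    refine hex.trans ?_
    rw [e2]
    linarith
  -- the window floor lemma
  obtain ⟨_, h2, h3⟩ := window_floor x R D τ ψ Φ lam Λ Ψ hx hR hΦd hΦ0 hx0 hR0 hlam0 hΛ0 hΨ0 hψΨ hDR hτb
  refine ⟨fun t ht => ?_, ?_⟩
  · -- the drain over the window: `Φ t ≤ Φ t₁ = q(1-4ρ/3) Σ τ_j Γ_j`
    have hΦmono : Φ t ≤ Φ t₁ := by
      rw [hΦ]
      refine Finset.sum_le_sum fun j _ => mul_le_mul_of_nonneg_left ?_ (hΓ0 j)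
      exact integral_trapSq_mono W j t₀ ht.2
    have hΦ1 : Φ t₁ = (q : ℝ) * (1 - 4 * W.ramp / 3) * ∑ j, (W.phase j).τ * Γ j := by
      rw [hΦ, Finset.mul_sum]
      refine Finset.sum_congr rfl fun j _ => ?_
      have := integral_trapSq_periods W j p q
      rw [htrap]
      simp only at this ⊢
      rw [this]; ring
    have := h2 t ht
    rw [← hΦ1]
    have hlt : lam * (x t₀ + R t₀) * (t - t₀) = 2 * (κ * (4 * Real.pi ^ 2 * freqNormSq ℓ)) * (x t₀ + R t₀) * (t - t₀) := by
      rw [hlam]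
    linarith
  · have := h3 t₁ ⟨ht₀₁, le_rfl⟩
    rw [hΛ] at this
    exact this

end Summit.AnomalousDissipation.AnomalousDissipation.Theorems.QuasiStaticSolenoidalCellTensorQ.Negative

end
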